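import Mathlib

/-!
# Single-level positivity — the topological-group content of sub-claim B5

Blind cell `pub-hodge-repro2`, Tier 4 (README §6.1), sub-claim B5 «single-level positivity + level»
(owner p8; prose in `route/T4-B5-p8.md`, Lemmas B5.4, B5.5, B5.7 and Theorem B5.1 (i)–(iii)).

What is formalised (Mathlib only; nothing below mentions a Shimura variety, an abelian variety or an
oscillator representation — every arithmetic input of the prose is a hypothesis here):

* Lemma B5.4: in a topological group, an open subgroup is closed (Mathlib's `OpenSubgroup.isClosed`),
  and the meet of an open compact subgroup with finitely many open subgroups is an open compact
  subgroup (`commonLevel`, `isCompact_commonLevel`, `commonLevel_le`).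
* Lemma B5.5: for a representation `ρ` of `G` on a `k`-vector space, the stabiliser of a vector is a
  subgroup (`stabilizer`); `ρ` is *smooth* when every stabiliser is open (`IsSmooth`, Getz–Hahn GTM 300
  Def. 5.3); invariants are antitone in the subgroup (`invariants_mono`); for finitely many smooth
  representations with chosen vectors `v i` and any open compact `K₀` there is an open compact
  `K ≤ K₀` fixing every `v i`, and every subgroup of `K` still fixes them (`exists_common_level`).
* Lemma B5.7 (the count): a non-zero invariant vector gives `1 ≤ finrank` of the (finite-dimensional)
  invariants (`one_le_finrank_invariants`); a finite sum of such finranks over an index set containing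
  the distinguished index is `≥ 1` (`one_le_sum_finrank_invariants`), also in the `finsum` form used
  for Liu's sum over ALL pairs `(ε, χ)` with finite support (`one_le_finsum_finrank_invariants`);
  the sums are antitone in the subgroup (`sum_finrank_invariants_mono`).
* Theorem B5.1 (i)–(iii), abstract form (`singleLevelPositivity`): for finitely many «vertices» `i`,
  each with an index type `J i` of pairs, a distinguished pair `j₀ i`, smooth representations
  `ω i j`, non-zero vectors `v i ∈ ω i (j₀ i)`, and an open compact threshold `K₀`, there is an open
  compact `K ≤ K₀` such that at every open compact `K' ≤ K` every count
  `∑ j ∈ s i, finrank (ω i j)^{K'}` (over any finite `s i ∋ j₀ i`) is `≥ 1`, provided the invariants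
  are finite-dimensional (admissibility, Getz–Hahn Def. 5.4).

Design: representations are Mathlib's `Representation k G V`; `K`-invariants of a subgroup `K` are
`(ρ.comp K.subtype).invariants` (`invariants ρ K`). The prose's `d(μ, K)` is the `finsum` over the
index type of pairs `(ε, χ)`; the finiteness of its support is the printed «the integer d(μ, K)»
(Liu 2021, Cor. 4.20) and enters as a hypothesis. No `sorry`; standard axioms only.
This file restates nothing from `LiuOscillator.lean` / `LiuFace.lean` (p2): those take a `Level`
semilattice with an antitone `dimInv` as STRUCTURE FIELDS; here those fields are PROVED for the
concrete semilattice of open compact subgroups of a topological group.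
-/

namespace Summit.Ventures.HodgeRepro2.LevelPositivity

noncomputable section

open Topology

section OpenCompact

variable {G : Type*} [Group G] [TopologicalSpace G] [IsTopologicalGroup G]

/-- Lemma B5.4(2): the meet of an open compact subgroup `K₀` with an open subgroup `U` is compact
(it is closed, being an open subgroup, and contained in the compact `K₀`). -/
theorem isCompact_inf_of_isCompact_left (K₀ U : OpenSubgroup G) (h : IsCompact (K₀ : Set G)) :
    IsCompact ((K₀ ⊓ U : OpenSubgroup G) : Set G) :=
  h.of_isClosed_subset (K₀ ⊓ U).isClosed
    (by rw [OpenSubgroup.coe_inf]; exact Set.inter_subset_left)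

/-- Lemma B5.4(3), the object: `K₀ ⊓ ⨅ i, S i` for a finite family `S` of open subgroups,
as an open subgroup. -/
def commonLevel {ι : Type*} [Finite ι] (K₀ : OpenSubgroup G) (S : ι → OpenSubgroup G) :
    OpenSubgroup G where
  toSubgroup := K₀.toSubgroup ⊓ ⨅ i, (S i).toSubgroup
  isOpen' := by
    change IsOpen ((K₀.toSubgroup ⊓ ⨅ i, (S i).toSubgroup : Subgroup G) : Set G)
    rw [Subgroup.coe_inf, Subgroup.coe_iInf]
    exact K₀.isOpen.inter (isOpen_iInter_of_finite fun i => (S i).isOpen)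

variable {ι : Type*} [Finite ι] (K₀ : OpenSubgroup G) (S : ι → OpenSubgroup G)

omit [IsTopologicalGroup G] in
/-- The underlying set of the common level is `K₀ ∩ ⋂ i, S i`. -/
@[simp] theorem coe_commonLevel :
    ((commonLevel K₀ S : OpenSubgroup G) : Set G) = (K₀ : Set G) ∩ ⋂ i, (S i : Set G) := by
  change ((K₀.toSubgroup ⊓ ⨅ i, (S i).toSubgroup : Subgroup G) : Set G) = _
  rw [Subgroup.coe_inf, Subgroup.coe_iInf]
  rfl

omit [IsTopologicalGroup G] in
/-- Membership in the common level: `g ∈ K₀` and `g ∈ S i` for every `i`. -/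
theorem mem_commonLevel {g : G} : g ∈ commonLevel K₀ S ↔ g ∈ K₀ ∧ ∀ i, g ∈ S i := by
  change g ∈ (K₀.toSubgroup ⊓ ⨅ i, (S i).toSubgroup : Subgroup G) ↔ _
  simp [Subgroup.mem_inf, Subgroup.mem_iInf]

omit [IsTopologicalGroup G] in
/-- The common level is contained in the threshold `K₀`. -/
theorem commonLevel_le : commonLevel K₀ S ≤ K₀ := fun _ hg => ((mem_commonLevel K₀ S).1 hg).1

omit [IsTopologicalGroup G] in
/-- The common level is contained in each `S i`. -/
theorem commonLevel_le_apply (i : ι) : commonLevel K₀ S ≤ S i :=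
  fun _ hg => ((mem_commonLevel K₀ S).1 hg).2 i

/-- Lemma B5.4(3): the common level is compact when `K₀` is. -/
theorem isCompact_commonLevel (h : IsCompact (K₀ : Set G)) :
    IsCompact ((commonLevel K₀ S : OpenSubgroup G) : Set G) :=
  h.of_isClosed_subset (commonLevel K₀ S).isClosed (commonLevel_le K₀ S)

end OpenCompact

section Stabilizer

variable {G : Type*} [Group G]
variable {k : Type*} [Field k] {V : Type*} [AddCommGroup V] [Module k V]

/-- Lemma B5.5(1): the stabiliser `{g : ρ g v = v}` of a vector, as a subgroup. -/
def stabilizer (ρ : Representation k G V) (v : V) : Subgroup G where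
  carrier := {g | ρ g v = v}
  one_mem' := by simp
  mul_mem' := by
    intro a b ha hb
    simp only [Set.mem_setOf_eq] at ha hb ⊢
    rw [map_mul, Module.End.mul_apply, hb, ha]
  inv_mem' := by
    intro a ha
    simp only [Set.mem_setOf_eq] at ha ⊢
    calc ρ a⁻¹ v = ρ a⁻¹ (ρ a v) := by rw [ha]
      _ = ρ (a⁻¹ * a) v := by rw [map_mul, Module.End.mul_apply]
      _ = v := by rw [inv_mul_cancel, map_one, Module.End.one_apply]

/-- `g` stabilises `v` iff `ρ g v = v`. -/
theorem mem_stabilizer_iff {ρ : Representation k G V} {v : V} {g : G} :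
    g ∈ stabilizer ρ v ↔ ρ g v = v := Iff.rfl

/-- The restriction of `ρ` to a subgroup `K`. -/
def restrict (ρ : Representation k G V) (K : Subgroup G) : Representation k K V :=
  ρ.comp K.subtype

/-- The restricted representation acts through the inclusion `K → G`. -/
@[simp] theorem restrict_apply (ρ : Representation k G V) (K : Subgroup G) (g : K) (v : V) :
    restrict ρ K g v = ρ (g : G) v := rfl

/-- The `K`-invariants `V^K` of `ρ`, a `k`-subspace of `V`. -/
abbrev invariants (ρ : Representation k G V) (K : Subgroup G) : Submodule k V :=
  (restrict ρ K).invariants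

/-- `v ∈ V^K` iff `ρ g v = v` for every `g ∈ K`. -/
theorem mem_invariants_iff {ρ : Representation k G V} {K : Subgroup G} {v : V} :
    v ∈ invariants ρ K ↔ ∀ g ∈ K, ρ g v = v := by
  rw [invariants, Representation.mem_invariants]
  exact ⟨fun h g hg => h ⟨g, hg⟩, fun h g => h g g.2⟩

/-- Lemma B5.5(2): invariants are antitone in the subgroup — `K' ≤ K` gives `V^K ⊆ V^{K'}`. -/
theorem invariants_mono {ρ : Representation k G V} {K K' : Subgroup G} (h : K' ≤ K) :
    invariants ρ K ≤ invariants ρ K' := fun _ hv =>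
  mem_invariants_iff.2 fun g hg => (mem_invariants_iff.1 hv) g (h hg)

/-- A vector is `K`-invariant as soon as `K` lies in its stabiliser. -/
theorem mem_invariants_of_le_stabilizer {ρ : Representation k G V} {K : Subgroup G} {v : V}
    (h : K ≤ stabilizer ρ v) : v ∈ invariants ρ K :=
  mem_invariants_iff.2 fun _ hg => (mem_stabilizer_iff).1 (h hg)

/-- Lemma B5.5(1) restated: `v` is invariant under its own stabiliser. -/
theorem mem_invariants_stabilizer (ρ : Representation k G V) (v : V) :
    v ∈ invariants ρ (stabilizer ρ v) :=
  mem_invariants_of_le_stabilizer le_rfl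

end Stabilizer

section Smooth

variable {G : Type*} [Group G] [TopologicalSpace G]
variable {k : Type*} [Field k] {V : Type*} [AddCommGroup V] [Module k V]

/-- A representation is *smooth* if the stabiliser of every vector is open
(Getz–Hahn, GTM 300, Definition 5.3). -/
def IsSmooth (ρ : Representation k G V) : Prop :=
  ∀ v : V, IsOpen ((stabilizer ρ v : Subgroup G) : Set G)

/-- The stabiliser of a vector of a smooth representation, as an open subgroup. -/
def openStabilizer (ρ : Representation k G V) (hρ : IsSmooth ρ) (v : V) : OpenSubgroup G :=
  ⟨stabilizer ρ v, hρ v⟩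

/-- The open stabiliser's underlying subgroup is the stabiliser. -/
@[simp] theorem openStabilizer_toSubgroup (ρ : Representation k G V) (hρ : IsSmooth ρ) (v : V) :
    (openStabilizer ρ hρ v).toSubgroup = stabilizer ρ v := rfl

end Smooth

section CommonLevel

variable {G : Type*} [Group G] [TopologicalSpace G] [IsTopologicalGroup G]
variable {k : Type*} [Field k]

/-- Lemma B5.5(3) (a common level). Given finitely many smooth representations `ρ i` with chosen
vectors `v i` and an open compact subgroup `K₀`, the open subgroup
`K := K₀ ⊓ ⨅ i, Stab(v i)` is compact, contained in `K₀`, and every subgroup `K' ≤ K`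
fixes every `v i`. -/
theorem exists_common_level {ι : Type*} [Finite ι] (V : ι → Type*) [∀ i, AddCommGroup (V i)]
    [∀ i, Module k (V i)] (ρ : ∀ i, Representation k G (V i)) (hρ : ∀ i, IsSmooth (ρ i))
    (v : ∀ i, V i) (K₀ : OpenSubgroup G) (hK₀ : IsCompact (K₀ : Set G)) :
    ∃ K : OpenSubgroup G, IsCompact (K : Set G) ∧ K ≤ K₀ ∧
      ∀ K' : Subgroup G, K' ≤ K.toSubgroup → ∀ i, v i ∈ invariants (ρ i) K' := by
  refine ⟨commonLevel K₀ fun i => openStabilizer (ρ i) (hρ i) (v i),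
    isCompact_commonLevel _ _ hK₀, commonLevel_le _ _, ?_⟩
  intro K' hK' i
  refine mem_invariants_of_le_stabilizer (hK'.trans ?_)
  exact commonLevel_le_apply K₀ (fun i => openStabilizer (ρ i) (hρ i) (v i)) i

end CommonLevel

section Count

variable {G : Type*} [Group G]
variable {k : Type*} [Field k]

/-- Lemma B5.7, one term: a non-zero `K`-invariant vector makes the (finite-dimensional)
space of `K`-invariants of dimension `≥ 1`. -/
theorem one_le_finrank_invariants {V : Type*} [AddCommGroup V] [Module k V]
    (ρ : Representation k G V) (K : Subgroup G) {v : V} (hv : v ≠ 0) (hvK : v ∈ invariants ρ K)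
    [FiniteDimensional k (invariants ρ K)] :
    1 ≤ Module.finrank k (invariants ρ K) :=
  Module.finrank_pos_iff_exists_ne_zero.2 ⟨⟨v, hvK⟩, fun h => hv (congrArg Subtype.val h)⟩

/-- Lemma B5.7, the count over a finite index set: if some index `j₀ ∈ s` carries a non-zero
`K`-invariant vector, the sum of the dimensions of the `K`-invariants over `s` is `≥ 1`.
(In the prose, `J` = the pairs `(ε, χ)` with `ε` `μ`-admissible, `j₀ = (ε_i, χ_i)`.) -/
theorem one_le_sum_finrank_invariants {J : Type*} (s : Finset J) (W : J → Type*)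
    [∀ j, AddCommGroup (W j)] [∀ j, Module k (W j)] (ω : ∀ j, Representation k G (W j))
    (K : Subgroup G) (j₀ : J) (hj₀ : j₀ ∈ s) {w : W j₀} (hw : w ≠ 0)
    (hwK : w ∈ invariants (ω j₀) K) [FiniteDimensional k (invariants (ω j₀) K)] :
    1 ≤ ∑ j ∈ s, Module.finrank k (invariants (ω j) K) :=
  (one_le_finrank_invariants (ω j₀) K hw hwK).trans
    (Finset.single_le_sum (f := fun j => Module.finrank k (invariants (ω j) K))
      (fun _ _ => Nat.zero_le _) hj₀)

/-- Lemma B5.7 in `finsum` form (Liu's `d(μ, K) = Σ_ε Σ_χ dim ω(μ, ε, χ)^K`, a sum over ALL pairs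
with finitely many non-zero terms — the printed «the integer d(μ, K)», Cor. 4.20): if the support
of `j ↦ dim (ω j)^K` is finite and one index `j₀` carries a non-zero `K`-invariant vector, then
`d ≥ 1`. -/
theorem one_le_finsum_finrank_invariants {J : Type*} (W : J → Type*)
    [∀ j, AddCommGroup (W j)] [∀ j, Module k (W j)] (ω : ∀ j, Representation k G (W j))
    (K : Subgroup G)
    (hfin : (Function.support fun j => Module.finrank k (invariants (ω j) K)).Finite)
    (j₀ : J) {w : W j₀} (hw : w ≠ 0) (hwK : w ∈ invariants (ω j₀) K)
    [FiniteDimensional k (invariants (ω j₀) K)] :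
    1 ≤ ∑ᶠ j, Module.finrank k (invariants (ω j) K) := by
  rw [finsum_eq_sum_of_support_subset _ (s := hfin.toFinset) (by simp)]
  refine one_le_sum_finrank_invariants hfin.toFinset W ω K j₀ ?_ hw hwK
  rw [Set.Finite.mem_toFinset, Function.mem_support]
  exact Nat.pos_iff_ne_zero.1 (one_le_finrank_invariants (ω j₀) K hw hwK)

/-- Lemma B5.5(2) + B5.7, monotonicity of the count: for `K' ≤ K` and finite-dimensional
`K'`-invariants, `∑ j ∈ s, dim (ω j)^K ≤ ∑ j ∈ s, dim (ω j)^{K'}`. -/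
theorem sum_finrank_invariants_mono {J : Type*} (s : Finset J) (W : J → Type*)
    [∀ j, AddCommGroup (W j)] [∀ j, Module k (W j)] (ω : ∀ j, Representation k G (W j))
    {K K' : Subgroup G} (h : K' ≤ K) [∀ j, FiniteDimensional k (invariants (ω j) K')] :
    ∑ j ∈ s, Module.finrank k (invariants (ω j) K) ≤
      ∑ j ∈ s, Module.finrank k (invariants (ω j) K') :=
  Finset.sum_le_sum fun _ _ => Submodule.finrank_mono (invariants_mono h)

end Count

section Main

variable {G : Type*} [Group G] [TopologicalSpace G] [IsTopologicalGroup G]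
variable {k : Type*} [Field k]

/-- **Theorem B5.1 (i)–(iii), abstract form.** Vertices `i : ι` (finitely many; four in the prose);
for each `i` an index type `J i` (the pairs `(ε, χ)`), representations `ω i j` of `G` on
`k`-vector spaces, all smooth; a distinguished index `j₀ i` (the pair `(ε_i, χ_i)`) and a non-zero
vector `v i` of `ω i (j₀ i)`; an open compact threshold `K₀` (the «sufficiently small» level of the
printed theorems); admissibility: the invariants under every open compact subgroup are
finite-dimensional. Then there is an open compact `K ≤ K₀` such that for every open compact
`K' ≤ K` and every `i`, the count `∑ j ∈ s, dim (ω i j)^{K'}` over any finite `s ∋ j₀ i` is `≥ 1`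
(positivity, (ii) and its persistence (iii)), and the counts are antitone in `K'`. -/
theorem singleLevelPositivity {ι : Type*} [Finite ι] (J : ι → Type*) (W : ∀ i, J i → Type*)
    [∀ i j, AddCommGroup (W i j)] [∀ i j, Module k (W i j)]
    (ω : ∀ i j, Representation k G (W i j)) (hω : ∀ i j, IsSmooth (ω i j))
    (j₀ : ∀ i, J i) (v : ∀ i, W i (j₀ i)) (hv : ∀ i, v i ≠ 0)
    (K₀ : OpenSubgroup G) (hK₀ : IsCompact (K₀ : Set G))
    (hadm : ∀ i j (K' : OpenSubgroup G), IsCompact (K' : Set G) →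
      FiniteDimensional k (invariants (ω i j) K'.toSubgroup)) :
    ∃ K : OpenSubgroup G, IsCompact (K : Set G) ∧ K ≤ K₀ ∧
      (∀ K' : OpenSubgroup G, K' ≤ K → IsCompact (K' : Set G) →
        ∀ i (s : Finset (J i)), j₀ i ∈ s →
          1 ≤ ∑ j ∈ s, Module.finrank k (invariants (ω i j) K'.toSubgroup)) ∧
      (∀ K' K'' : OpenSubgroup G, K'' ≤ K' → K' ≤ K → IsCompact (K'' : Set G) →
        ∀ i (s : Finset (J i)),
          ∑ j ∈ s, Module.finrank k (invariants (ω i j) K'.toSubgroup) ≤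
            ∑ j ∈ s, Module.finrank k (invariants (ω i j) K''.toSubgroup)) := by
  obtain ⟨K, hKc, hKle, hKfix⟩ :=
    exists_common_level (fun i => W i (j₀ i)) (fun i => ω i (j₀ i)) (fun i => hω i (j₀ i)) v K₀ hK₀
  refine ⟨K, hKc, hKle, ?_, ?_⟩
  · intro K' hK' hK'c i s hs
    haveI := hadm i (j₀ i) K' hK'c
    exact one_le_sum_finrank_invariants s (W i) (ω i) K'.toSubgroup (j₀ i) hs (hv i)
      (hKfix K'.toSubgroup hK' i)
  · intro K' K'' h₁ _ hK''c i s
    haveI : ∀ j, FiniteDimensional k (invariants (ω i j) K''.toSubgroup) :=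
      fun j => hadm i j K'' hK''c
    exact sum_finrank_invariants_mono s (W i) (ω i) h₁

end Main

end

end Summit.Ventures.HodgeRepro2.LevelPositivity
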